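import Literature.NumberTheory.Automorphic.TruncatedKernelCompact
import Literature.NumberTheory.Automorphic.FuchsianJointEigenfunction
import Literature.Analysis.OperatorTheory.EssentialSpectrumTop

/-!
# The quadratic form of an invariant operator away from the small eigenfunctions is bounded by its symbol
(Iwaniec, *Spectral Methods of Automorphic Forms*, GSM 53, Theorem 7.3 / (7.11) and Theorem 7.4 /
(7.17): on the orthogonal complement of the eigenfunctions with `λ_j < 1/4` an invariant integral
operator acts through the "tempered" part of its symbol `h(t)`, `t ∈ ℝ`; PDF pp. 74–76)

Sixth brick of the Eisenstein-free proof of the pretrace estimate (12.5)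
(`Literature.NumberTheory.Automorphic.Iwaniec2002_eq_12_5`). Let `Γ` be a finite-volume group
(matrices, `-1 ∈ Γ`, fundamental domain `F`, cusp data `σ_i`), `{u_j}` its small eigenbasis
(`SmallEigenbasis Γ F`), `S = span{[u_j]} ⊆ L²(F)`, and let `N` be a bounded self-adjoint operator on
`L²(F)` commuting with all `T_k` (`k` Lipschitz test kernels), with `N Λ` compact (`Λ` the truncation
of `TruncatedKernelCompact`), with `Re ⟨N Q g, Q g⟩ ≤ β ‖Q g‖²` on the functions of the height
(`Q = 1 - Λ`; `TruncatedFormBound`), `0 ≤ β`, and acting on every `Δ`-eigenfunction of spectral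
parameter `t` by a scalar `σ(t)` with `Re σ(t) ≤ β` for real `t`. Then
**`Re ⟨N f, f⟩ ≤ β ‖f‖²` for every `f ⊥ S`** (`re_inner_le_of_symbol_le`).

Proof (the operator-theoretic substitute for the spectral expansion (7.17)): the compression
`A = (1-P) N (1-P)` (`P` the projection onto `S`) differs from `(1-P)[Λ N Q + Q N Q - Q N Λ](1-P)`,
whose form is `Re ⟨N Q g, Q g⟩ ≤ β ‖g‖²`, by a compact operator; so by
`Literature.Analysis.OperatorTheory.exists_finiteDimensional_invariant_top` the part of `A` above
`β + ε` lives on a finite-dimensional subspace `W` invariant under every `T_k`; `W ⊆ Sᗮ`; a joint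
eigenvector `v ∈ W` of the commuting self-adjoint family `T_k` is a `Δ`-eigenfunction
(`exists_eigenfunction_of_isJointEigenvector`) with `Re σ(t) ≥ β + ε`, hence `t ∉ ℝ`, hence
`λ = 1/4 + t² < 1/4`, hence (completeness of the small eigenbasis) `v ∈ S ∩ Sᗮ = 0` — absurd.

Everything here is proved; nothing is vendored; no fact is introduced.

## References
* [Iwaniec2002] H. Iwaniec, *Spectral Methods of Automorphic Forms*, 2nd ed., GSM 53, AMS 2002,
  Thm 7.3 (7.11), Thm 7.4 (7.17), PDF pp. 74–76 (held copy `book:iwaniec2002-spectral-methods-automorphic-forms`).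
-/

noncomputable section

open MeasureTheory Set Filter Real UpperHalfPlane
open scoped Topology MatrixGroups ComplexConjugate NNReal ENNReal Pointwise InnerProductSpace InnerProduct

namespace Literature.NumberTheory.Automorphic

variable {Γ : Subgroup (GL (Fin 2) ℝ)} {F : Set ℍ}

/-! ## 1. The small eigenbasis in `L²(F)` -/

section Basis

/-- `u_j ∈ L²(F)`. [folklore] -/
theorem SmallEigenbasis.memLp (B : SmallEigenbasis Γ F) (j : Fin B.n) :
    MemLp (B.u j) 2 ((volume : Measure ℍ).restrict F) :=
  (memLp_two_iff_integrable_sq_norm (B.isC2 j).continuous.aestronglyMeasurable).2 (B.sqIntegrable j)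

/-- The classes `e_j = [u_j] ∈ L²(F)` of the small eigenfunctions. [cite: Iwaniec2002, Thm 7.3, PDF p. 74] -/
def SmallEigenbasis.vec (B : SmallEigenbasis Γ F) (j : Fin B.n) : Lp ℂ 2 ((volume : Measure ℍ).restrict F) :=
  (B.memLp j).toLp (B.u j)

/-- The representative of `e_j`. [folklore] -/
theorem SmallEigenbasis.vec_coeFn (B : SmallEigenbasis Γ F) (j : Fin B.n) :
    ⇑(B.vec j) =ᵐ[(volume : Measure ℍ).restrict F] B.u j :=
  (B.memLp j).coeFn_toLp

/-- `⟨e_i, e_j⟩ = δ_{ij}`. [folklore] -/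
theorem SmallEigenbasis.inner_vec (B : SmallEigenbasis Γ F) (i j : Fin B.n) :
    ⟪B.vec i, B.vec j⟫_ℂ = if i = j then 1 else 0 := by
  rw [L2.inner_def]
  have e : ∫ z, ⟪(B.vec i : ℍ → ℂ) z, (B.vec j : ℍ → ℂ) z⟫_ℂ ∂((volume : Measure ℍ).restrict F) =
      ∫ z in F, B.u j z * conj (B.u i z) := by
    refine integral_congr_ae ?_
    filter_upwards [B.vec_coeFn i, B.vec_coeFn j] with z hz hz'
    rw [hz, hz', RCLike.inner_apply]
  rw [e, B.orthonormal j i]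
  by_cases h : i = j
  · subst h; simp
  · rw [if_neg (Ne.symm h), if_neg h]

/-- The `e_j` are orthonormal. [folklore] -/
theorem SmallEigenbasis.orthonormal_vec (B : SmallEigenbasis Γ F) : Orthonormal ℂ B.vec := by
  rw [orthonormal_iff_ite]
  intro i j
  exact B.inner_vec i j

/-- The spectral parameter `t_j = i(s_j - 1/2)` of `u_j`: `1/4 + t_j² = s_j(1 - s_j)`. [cite: Iwaniec2002, (7.11), PDF p. 74] -/
theorem SmallEigenbasis.quarter_add_sq (B : SmallEigenbasis Γ F) (j : Fin B.n) :
    (1 / 4 : ℂ) + (Complex.I * ((B.s j - 1 / 2 : ℝ) : ℂ)) ^ 2 = ((B.s j * (1 - B.s j) : ℝ) : ℂ) := by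
  rw [mul_pow, Complex.I_sq]
  push_cast
  ring

/-- The eigen-equation of `u_j` with the spectral parameter `t_j`. [cite: Iwaniec2002, (7.11), PDF p. 74] -/
theorem SmallEigenbasis.eigen' (B : SmallEigenbasis Γ F) (j : Fin B.n) (z : ℍ) :
    hypLaplacian (B.u j) z + (1 / 4 + (Complex.I * ((B.s j - 1 / 2 : ℝ) : ℂ)) ^ 2) * B.u j z = 0 := by
  rw [B.quarter_add_sq j]
  exact B.eigen j z

variable (hΓ : Γ ≤ (Matrix.SpecialLinearGroup.toGL : SL(2, ℝ) →* GL (Fin 2) ℝ).range)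
  (hneg : (-1 : GL (Fin 2) ℝ) ∈ Γ) (hd : IsDiscreteSubgroup Γ) (hF : IsHypFundamentalDomain Γ F)

include hΓ hneg hd hF in
/-- **`T_k e_j = h(t_j) e_j`** (Theorem 1.16). [cite: Iwaniec2002, Thm 1.16 & (7.17), PDF pp. 24, 76] -/
theorem SmallEigenbasis.kernelCLM_vec (B : SmallEigenbasis Γ F) {k : ℝ → ℝ} (hk : IsTestKernel k)
    (hkc : Continuous k) (j : Fin B.n) :
    kernelCLM hΓ hneg hd hF hk hkc (B.vec j) =
      selbergTransform k (Complex.I * ((B.s j - 1 / 2 : ℝ) : ℂ)) • B.vec j :=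
  kernelCLM_toLp_eigenfunction hΓ hneg hd hF hk hkc (B.isAutomorphic j) (B.isC2 j) _ (B.eigen' j) (B.memLp j)

end Basis

/-! ## 2. Two lemmas of linear algebra -/

section LinearAlgebra

variable {E : Type*} [NormedAddCommGroup E] [InnerProductSpace ℂ E] [CompleteSpace E]

/-- A self-adjoint operator leaving a subspace with orthogonal projection invariant commutes with
the projection. [folklore] -/
theorem commute_starProjection_of_invariant (K : Submodule ℂ E) [K.HasOrthogonalProjection]
    {T : E →L[ℂ] E} (hT : IsSelfAdjoint T) (hK : ∀ x ∈ K, T x ∈ K) : Commute T K.starProjection := by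
  have hKo : ∀ y ∈ Kᗮ, T y ∈ Kᗮ := by
    intro y hy
    rw [Submodule.mem_orthogonal]
    intro x hx
    conv_lhs => rw [← hT.adjoint_eq]
    rw [ContinuousLinearMap.adjoint_inner_right]
    exact Submodule.inner_right_of_mem_orthogonal (hK x hx) hy
  refine ContinuousLinearMap.ext fun f => ?_
  change T (K.starProjection f) = K.starProjection (T f)
  have hsplit : T f = T (K.starProjection f) + T (f - K.starProjection f) := by
    rw [← map_add, add_sub_cancel]
  rw [hsplit, map_add, (Submodule.starProjection_eq_self_iff).mpr (hK _ (Submodule.starProjection_apply_mem K f)),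
    (Submodule.starProjection_apply_eq_zero_iff K).mpr (hKo _ (Submodule.sub_starProjection_mem_orthogonal f)),
    add_zero]

/-- **A commuting family of self-adjoint operators has a joint eigenvector in every non-zero
finite-dimensional invariant subspace** (simultaneous diagonalisation). [folklore] -/
theorem exists_joint_eigenvector_of_invariant {ι : Type*} (T : ι → E →L[ℂ] E)
    (hsa : ∀ i, IsSelfAdjoint (T i)) (hcomm : ∀ i j, Commute (T i) (T j))
    (W : Submodule ℂ E) [FiniteDimensional ℂ W] (hW : W ≠ ⊥) (hinv : ∀ i, ∀ w ∈ W, T i w ∈ W) :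
    ∃ v ∈ W, v ≠ 0 ∧ ∀ i, ∃ c : ℂ, T i v = c • v := by
  let R : ι → W →ₗ[ℂ] W := fun i => ((T i : E →ₗ[ℂ] E)).restrict (hinv i)
  have hRapply : ∀ i (v : W), ((R i v : W) : E) = T i (v : E) := fun i v => rfl
  have hRsym : ∀ i, (R i).IsSymmetric := fun i => (hsa i).isSymmetric.restrict_invariant (hinv i)
  have hRcomm : Pairwise (Function.onFun Commute R) := by
    intro i i' _
    ext v
    change (((R i) ((R i') v) : W) : E) = (((R i') ((R i) v) : W) : E)
    rw [hRapply, hRapply, hRapply, hRapply]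
    have h := congrArg (fun f : E →L[ℂ] E => f (v : E)) (hcomm i i')
    simpa only [ContinuousLinearMap.mul_def, ContinuousLinearMap.comp_apply] using h
  have htop := LinearMap.IsSymmetric.iSup_iInf_eq_top_of_commute hRsym hRcomm
  have hVne : (⊤ : Submodule ℂ W) ≠ ⊥ := by
    intro h
    apply hW
    rw [Submodule.eq_bot_iff]
    intro x hx
    have : (⟨x, hx⟩ : W) ∈ (⊤ : Submodule ℂ W) := Submodule.mem_top
    rw [h, Submodule.mem_bot] at this
    exact congrArg Subtype.val this
  rw [← htop] at hVne
  obtain ⟨χ, hχ⟩ : ∃ χ : ι → ℂ, (⨅ i, Module.End.eigenspace (R i) (χ i)) ≠ ⊥ := by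
    by_contra h
    push Not at h
    apply hVne
    simp [h]
  obtain ⟨v, hv, hv0⟩ := Submodule.exists_mem_ne_zero_of_ne_bot hχ
  refine ⟨(v : E), v.2, ?_, ?_⟩
  · intro h0
    apply hv0
    exact Subtype.ext h0
  · intro i
    refine ⟨χ i, ?_⟩
    have h1 : R i v = χ i • v := Module.End.mem_eigenspace_iff.mp ((Submodule.mem_iInf _).mp hv i)
    have h2 := congrArg (fun y : W => (y : E)) h1
    simpa only [hRapply, Submodule.coe_smul] using h2

omit [CompleteSpace E] in
/-- Membership in the orthogonal complement of the span of a family. [folklore] -/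
theorem mem_orthogonal_span_range_iff {ι : Type*} (e : ι → E) (f : E) :
    f ∈ (Submodule.span ℂ (Set.range e))ᗮ ↔ ∀ j, ⟪e j, f⟫_ℂ = 0 := by
  constructor
  · intro hf j
    exact Submodule.inner_right_of_mem_orthogonal (Submodule.subset_span (Set.mem_range_self j)) hf
  · intro h
    rw [Submodule.mem_orthogonal]
    intro u hu
    refine Submodule.span_induction (p := fun u _ => ⟪u, f⟫_ℂ = 0) ?_ ?_ ?_ ?_ hu
    · rintro _ ⟨j, rfl⟩; exact h j
    · exact inner_zero_left _
    · intro x y _ _ hx hy; rw [inner_add_left, hx, hy, add_zero]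
    · intro c x _ hx; rw [inner_smul_left, hx, mul_zero]

end LinearAlgebra

namespace Fuchsian

variable {h : ℕ} {𝔞 : Fin h → OnePoint ℝ} {σ : Fin h → SL(2, ℝ)}

set_option quotPrecheck false in
/-- `L²(F)`. -/
local notation "L2F" => Lp ℂ 2 ((volume : Measure ℍ).restrict F)

/-! ## 3. The form bound on `Sᗮ` -/

section Main

variable (hΓ : Γ ≤ (Matrix.SpecialLinearGroup.toGL : SL(2, ℝ) →* GL (Fin 2) ℝ).range)
  (hneg : (-1 : GL (Fin 2) ℝ) ∈ Γ) (hd : IsDiscreteSubgroup Γ) (hF : IsHypFundamentalDomain Γ F)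
  (hinfty : ∀ i, (Matrix.SpecialLinearGroup.toGL (σ i) : GL (Fin 2) ℝ) • (OnePoint.infty : OnePoint ℝ) = 𝔞 i)
  (hper : ∀ i, (ConjAct.toConjAct (Matrix.SpecialLinearGroup.toGL (σ i) : GL (Fin 2) ℝ)⁻¹ • Γ).strictPeriods =
    AddSubgroup.zmultiples 1)
  (hineq : ∀ i j, ∀ γ ∈ Γ, γ • 𝔞 i = 𝔞 j → i = j)

/-- A non-real complex number with real square is purely imaginary with negative square:
if `1/4 + t² = μ ∈ ℝ` and `t ∉ ℝ` then `μ < 1/4`. [folklore] -/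
theorem quarter_add_sq_lt_of_not_real {t : ℂ} {μ : ℝ} (hμ : (1 / 4 : ℂ) + t ^ 2 = μ) (ht : ∀ r : ℝ, t ≠ r) :
    μ < 1 / 4 := by
  have him : t.re * t.im = 0 := by
    have h := congrArg Complex.im hμ
    simp [sq, Complex.add_im, Complex.mul_im] at h
    linarith
  have hre : t.re = 0 := by
    rcases mul_eq_zero.mp him with h | h
    · exact h
    · exfalso
      exact ht t.re (Complex.ext (by simp) (by simp [h]))
  have him0 : t.im ≠ 0 := by
    intro h
    exact ht 0 (Complex.ext (by simp [hre]) (by simp [h]))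
  have h := congrArg Complex.re hμ
  simp [sq, Complex.add_re, Complex.mul_re, hre] at h
  have : 0 < t.im * t.im := mul_self_pos.mpr him0
  norm_num at h
  linarith

include hΓ hneg hd hF hinfty hper hineq in
/-- **The form bound on `Sᗮ`.** Let `N` be a bounded self-adjoint operator on `L²(F)` commuting with
all `T_k` (`k` Lipschitz test kernels), with `N Λ` compact, `Re ⟨N Q g, Q g⟩ ≤ β ‖Q g‖²` (`0 ≤ β`),
acting on (the classes of) the `Δ`-eigenfunctions of spectral parameter `t` by scalars `σ(t)` with
`Re σ(t) ≤ β` for all real `t`. Then `Re ⟨N f, f⟩ ≤ β ‖f‖²` for every `f` orthogonal to the small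
eigenfunctions `u_j`. (The operator-theoretic content of (7.17) restricted to `Sᗮ`: there only the
tempered spectrum `t ∈ ℝ` contributes.) [cite: Iwaniec2002, Thm 7.3 (7.11) & Thm 7.4 (7.17), PDF pp. 74–76] -/
theorem re_inner_le_of_symbol_le (B : SmallEigenbasis Γ F) {Y : ℝ} (hY : 1 ≤ Y)
    {N : L2F →L[ℂ] L2F} (hN : IsSelfAdjoint N)
    (hcomm : ∀ (k : ℝ → ℝ) (hk : IsTestKernel k) (L : ℝ≥0) (hL : LipschitzWith L k),
      Commute N (kernelCLM hΓ hneg hd hF hk hL.continuous))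
    (hcpt : IsCompactOperator (N ∘L truncOp hΓ hneg hd hF hper hY))
    {β : ℝ} (hβ0 : 0 ≤ β)
    (hform : ∀ g : L2F, (⟪N (cuspQ hΓ hneg hd hF hper hY g), cuspQ hΓ hneg hd hF hper hY g⟫_ℂ).re ≤
      β * ‖cuspQ hΓ hneg hd hF hper hY g‖ ^ 2)
    (symb : ℂ → ℂ)
    (hsymb : ∀ (u : ℍ → ℂ) (t : ℂ) (v : L2F), IsDeltaEigenfunction Γ u t →
      u =ᵐ[(volume : Measure ℍ).restrict F] v → N v = symb t • v)
    (hβs : ∀ t : ℝ, (symb t).re ≤ β)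
    (f : L2F) (hf : ∀ j, ⟪B.vec j, f⟫_ℂ = 0) :
    (⟪N f, f⟫_ℂ).re ≤ β * ‖f‖ ^ 2 := by
  classical
  -- self-adjoint operators move across the inner product
  have hsa_inner : ∀ {X : L2F →L[ℂ] L2F}, IsSelfAdjoint X → ∀ a b : L2F, ⟪X a, b⟫_ℂ = ⟪a, X b⟫_ℂ := by
    intro X hX a b
    rw [← ContinuousLinearMap.adjoint_inner_right X a b, hX.adjoint_eq]
  -- the subspace `S` and its projection `P`
  set S : Submodule ℂ L2F := Submodule.span ℂ (Set.range B.vec) with hS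
  haveI : FiniteDimensional ℂ S := FiniteDimensional.span_of_finite ℂ (Set.finite_range _)
  haveI : CompleteSpace S := FiniteDimensional.complete ℂ S
  haveI : S.HasOrthogonalProjection := Submodule.HasOrthogonalProjection.ofCompleteSpace S
  set P : L2F →L[ℂ] L2F := S.starProjection with hP
  have hPsp : IsStarProjection P := isStarProjection_starProjection
  set Q : L2F →L[ℂ] L2F := cuspQ hΓ hneg hd hF hper hY with hQ
  set Λ : L2F →L[ℂ] L2F := truncOp hΓ hneg hd hF hper hY with hΛ
  have hΛQ : ∀ g : L2F, Λ g + Q g = g := by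
    intro g
    rw [hΛ, truncOp, sub_apply, one_apply_eq_self, ← hQ, sub_add_cancel]
  have hQsa : IsSelfAdjoint Q := isSelfAdjoint_cuspQ hΓ hneg hd hF hper hY
  have hΛsa : IsSelfAdjoint Λ := isSelfAdjoint_truncOp hΓ hneg hd hF hinfty hper hineq hY
  -- `T_k S ⊆ S`, so `T_k` commutes with `P`
  have hTS : ∀ (k : ℝ → ℝ) (hk : IsTestKernel k) (hkc : Continuous k), ∀ x ∈ S, kernelCLM hΓ hneg hd hF hk hkc x ∈ S := by
    intro k hk hkc x hx
    have hle : S.map (kernelCLM hΓ hneg hd hF hk hkc : L2F →ₗ[ℂ] L2F) ≤ S := by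
      rw [hS, Submodule.map_span_le]
      rintro _ ⟨j, rfl⟩
      rw [ContinuousLinearMap.coe_coe, B.kernelCLM_vec hΓ hneg hd hF hk hkc j]
      exact Submodule.smul_mem _ _ (Submodule.subset_span (Set.mem_range_self j))
    exact hle (Submodule.mem_map_of_mem hx)
  have hTP : ∀ (k : ℝ → ℝ) (hk : IsTestKernel k) (L : ℝ≥0) (hL : LipschitzWith L k),
      Commute (kernelCLM hΓ hneg hd hF hk hL.continuous) P := fun k hk L hL =>
    commute_starProjection_of_invariant S (isSelfAdjoint_kernelCLM hΓ hneg hd hF hk hL.continuous)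
      (hTS k hk hL.continuous)
  -- `f ⊥ S`
  have hfS : f ∈ Sᗮ := (mem_orthogonal_span_range_iff B.vec f).mpr hf
  -- by contradiction
  by_contra hcon
  push Not at hcon
  have hf0 : f ≠ 0 := by
    rintro rfl
    simp at hcon
  have hnf : 0 < ‖f‖ ^ 2 := by positivity
  set βs : ℝ := (⟪N f, f⟫_ℂ).re / ‖f‖ ^ 2 with hβs_def
  have hβs_eq : (⟪N f, f⟫_ℂ).re = βs * ‖f‖ ^ 2 := by rw [hβs_def, div_mul_cancel₀ _ hnf.ne']
  have hβlt : β < βs := by rw [hβs_def, lt_div_iff₀ hnf]; exact hcon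
  set ε : ℝ := (βs - β) / 3 with hε
  have hε0 : 0 < ε := by rw [hε]; linarith
  -- the compression `A = (1 - P) N (1 - P)`
  set R : L2F →L[ℂ] L2F := 1 - P with hR
  have hRsp : IsStarProjection R := hPsp.one_sub
  have hRsa : IsSelfAdjoint R := hRsp.isSelfAdjoint
  have hRnorm : ∀ g : L2F, ‖R g‖ ≤ ‖g‖ := fun g =>
    (R.le_opNorm g).trans (mul_le_of_le_one_left (norm_nonneg _) (IsStarProjection.norm_le _ hRsp))
  have hR_of_orth : ∀ g ∈ Sᗮ, R g = g := by
    intro g hg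
    rw [hR, sub_apply, one_apply_eq_self, (Submodule.starProjection_apply_eq_zero_iff S).mpr hg, sub_zero]
  have hR_of_mem : ∀ g ∈ S, R g = 0 := by
    intro g hg
    rw [hR, sub_apply, one_apply_eq_self, Submodule.starProjection_eq_self_iff.mpr hg, sub_self]
  set A : L2F →L[ℂ] L2F := R * N * R with hA
  have hAsa : IsSelfAdjoint A := by
    have h := hN.conjugate' R
    rwa [hRsa.star_eq] at h
  have hA_apply : ∀ g : L2F, A g = R (N (R g)) := fun g => rfl
  -- its compact part
  set C₀ : L2F →L[ℂ] L2F := N * Λ + Q * (N * Λ) with hC₀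
  have hNΛ : IsCompactOperator (N * Λ) := hcpt
  have hC₀c : IsCompactOperator C₀ := hNΛ.add (hNΛ.clm_comp Q)
  set C : L2F →L[ℂ] L2F := R * C₀ * R with hC
  have hCc : IsCompactOperator C := (hC₀c.clm_comp R).comp_clm R
  have hC_apply : ∀ g : L2F, C g = R (C₀ (R g)) := fun g => rfl
  -- the form of `A - C`
  have hB : ∀ g : L2F, (⟪(A - C) g, g⟫_ℂ).re ≤ β * ‖g‖ ^ 2 := by
    intro g
    set g' : L2F := R g with hg'
    have e1 : ⟪(A - C) g, g⟫_ℂ = ⟪N g' - C₀ g', g'⟫_ℂ := by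
      rw [sub_apply, hA_apply, hC_apply, ← map_sub, hsa_inner hRsa]
    -- `(N - C₀) g' = N Q g' - Q N Λ g'`
    have e2 : N g' - C₀ g' = N (Q g') - Q (N (Λ g')) := by
      have h1 : N g' = N (Λ g') + N (Q g') := by rw [← map_add, hΛQ]
      have hC₀g : C₀ g' = N (Λ g') + Q (N (Λ g')) := rfl
      rw [hC₀g, h1]
      abel
    -- `⟨N Q g', g'⟩ = ⟨N Q g', Λ g'⟩ + ⟨N Q g', Q g'⟩`
    have e3 : ⟪N (Q g'), g'⟫_ℂ = ⟪N (Q g'), Λ g'⟫_ℂ + ⟪N (Q g'), Q g'⟫_ℂ := by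
      rw [← inner_add_right, hΛQ]
    -- `Re ⟨N Q g', Λ g'⟩ = Re ⟨Q N Λ g', g'⟩`
    have e4 : (⟪N (Q g'), Λ g'⟫_ℂ).re = (⟪Q (N (Λ g')), g'⟫_ℂ).re := by
      rw [hsa_inner hN, hsa_inner hQsa, ← inner_conj_symm, Complex.conj_re]
    rw [e1, e2, inner_sub_left, e3, Complex.sub_re, Complex.add_re, e4]
    have h5 := hform g'
    have h6 : ‖cuspQ hΓ hneg hd hF hper hY g'‖ ^ 2 ≤ ‖g‖ ^ 2 := by
      have := (norm_cuspQ_apply_le hΓ hneg hd hF hinfty hper hineq hY g').trans (hRnorm g)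
      exact pow_le_pow_left₀ (norm_nonneg _) this 2
    calc (⟪Q (N (Λ g')), g'⟫_ℂ).re + (⟪N (Q g'), Q g'⟫_ℂ).re - (⟪Q (N (Λ g')), g'⟫_ℂ).re
        = (⟪N (Q g'), Q g'⟫_ℂ).re := by ring
      _ ≤ β * ‖cuspQ hΓ hneg hd hF hper hY g'‖ ^ 2 := h5
      _ ≤ β * ‖g‖ ^ 2 := mul_le_mul_of_nonneg_left h6 hβ0
  -- the finite-dimensional top of the spectrum of `A`
  obtain ⟨W, hWfd, hWinv, hWlow, hWup⟩ :=
    Literature.Analysis.OperatorTheory.exists_finiteDimensional_invariant_top hAsa hCc hε0 hB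
  -- on `Sᗮ` the forms of `A` and `N` agree
  have hA_orth : ∀ g ∈ Sᗮ, ⟪A g, g⟫_ℂ = ⟪N g, g⟫_ℂ := by
    intro g hg
    rw [hA_apply, hR_of_orth g hg, hsa_inner hRsa, hR_of_orth g hg]
  -- `W ≠ 0`
  have hW0 : W ≠ ⊥ := by
    intro hW
    have hfW : f ∈ Wᗮ := by rw [hW, Submodule.bot_orthogonal_eq_top]; trivial
    have h1 := hWup f hfW
    rw [hA_orth f hfS, hβs_eq] at h1
    have h2 : βs ≤ β + 2 * ε := le_of_mul_le_mul_right h1 hnf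
    rw [hε] at h2
    linarith
  -- `W ⊆ Sᗮ`
  have hPA : Commute P A := by
    have hPR : P * R = 0 := by rw [hR, mul_sub, mul_one, hPsp.isIdempotentElem.eq, sub_self]
    have hRP : R * P = 0 := by rw [hR, sub_mul, one_mul, hPsp.isIdempotentElem.eq, sub_self]
    change P * A = A * P
    rw [hA, ← mul_assoc, ← mul_assoc, hPR, zero_mul, zero_mul, mul_assoc, hRP, mul_zero]
  have hWS : ∀ w ∈ W, w ∈ Sᗮ := by
    intro w hw
    have hPw : P w ∈ W := hWinv P hPA w hw
    have hPwS : P w ∈ S := Submodule.starProjection_apply_mem S w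
    have hAx : A (P w) = 0 := by rw [hA_apply, hR_of_mem _ hPwS, map_zero, map_zero]
    have h1 := hWlow (P w) hPw
    rw [hAx, inner_zero_left, Complex.zero_re] at h1
    have h2 : ‖P w‖ ^ 2 ≤ 0 := by
      by_contra h3
      have : 0 < (β + ε) * ‖P w‖ ^ 2 := mul_pos (by linarith) (not_le.mp h3)
      linarith
    have h3 : P w = 0 := by
      have : ‖P w‖ ^ 2 = 0 := le_antisymm h2 (sq_nonneg _)
      rwa [sq_eq_zero_iff, norm_eq_zero] at this
    exact (Submodule.starProjection_apply_eq_zero_iff S).mp h3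
  -- `W` is invariant under every `T_k`
  have hWT : ∀ (k : ℝ → ℝ) (hk : IsTestKernel k) (L : ℝ≥0) (hL : LipschitzWith L k),
      ∀ w ∈ W, kernelCLM hΓ hneg hd hF hk hL.continuous w ∈ W := by
    intro k hk L hL
    refine hWinv _ ?_
    have h1 : Commute (kernelCLM hΓ hneg hd hF hk hL.continuous) R :=
      (Commute.one_right _).sub_right (hTP k hk L hL)
    have h2 : Commute (kernelCLM hΓ hneg hd hF hk hL.continuous) N := (hcomm k hk L hL).symm
    rw [hA]
    exact (h1.mul_right h2).mul_right h1
  -- a joint eigenvector in `W`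
  haveI := hWfd
  let ι := {p : (ℝ → ℝ) × ℝ≥0 // IsTestKernel p.1 ∧ LipschitzWith p.2 p.1}
  let T : ι → L2F →L[ℂ] L2F := fun p => kernelCLM hΓ hneg hd hF p.2.1 p.2.2.continuous
  obtain ⟨v, hvW, hv0, hveig⟩ := exists_joint_eigenvector_of_invariant T
    (fun p => isSelfAdjoint_kernelCLM hΓ hneg hd hF p.2.1 p.2.2.continuous)
    (fun p q => commute_kernelCLM hΓ hneg hd hF p.2.1 p.2.2.continuous q.2.1 q.2.2.continuous)
    W hW0 (fun p => hWT p.1.1 p.2.1 p.1.2 p.2.2)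
  have hj : IsJointEigenvector hΓ hneg hd hF v := fun k hk L hL => hveig ⟨(k, L), hk, hL⟩
  obtain ⟨u, t, hu, huv⟩ := exists_eigenfunction_of_isJointEigenvector hΓ hneg hd hF hv0 hj
  have hNv : N v = symb t • v := hsymb u t v hu huv
  -- `Re σ(t) ≥ β + ε`, so `t ∉ ℝ`
  have hvS : v ∈ Sᗮ := hWS v hvW
  have hvn : 0 < ‖v‖ ^ 2 := by positivity
  have hAv : (⟪A v, v⟫_ℂ).re = (symb t).re * ‖v‖ ^ 2 := by
    have h1 : ⟪v, v⟫_ℂ = ((‖v‖ ^ 2 : ℝ) : ℂ) := by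
      rw [inner_self_eq_norm_sq_to_K]; norm_cast
    rw [hA_orth v hvS, hNv, inner_smul_left, h1, Complex.mul_re, Complex.ofReal_re, Complex.ofReal_im, mul_zero,
      sub_zero, Complex.conj_re]
  have hre : β + ε ≤ (symb t).re := by
    have h1 := hWlow v hvW
    rw [hAv] at h1
    exact le_of_mul_le_mul_right h1 hvn
  have ht : ∀ r : ℝ, t ≠ r := by
    intro r hr
    have := hβs r
    rw [← hr] at this
    linarith
  -- `λ = 1/4 + t² < 1/4`, so `u` is a combination of the `u_j` and `v ∈ S`
  obtain ⟨μ, hμ⟩ := hu.real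
  have hμlt := quarter_add_sq_lt_of_not_real hμ ht
  have heig : ∀ z, hypLaplacian u z + (μ : ℂ) * u z = 0 := fun z => by rw [← hμ]; exact hu.eigen z
  obtain ⟨c, hc⟩ := B.complete u μ hμlt hu.automorphic hu.isC2 heig (integrableOn_norm_sq_of_ae_eq huv)
  have hvS' : v ∈ S := by
    have hv_eq : v = ∑ j, c j • B.vec j := by
      refine Lp.ext ?_
      have h1 : ⇑(∑ j, c j • B.vec j) =ᵐ[(volume : Measure ℍ).restrict F] fun z => ∑ j, c j * B.u j z := by
        have h2 : ∀ j, ⇑(c j • B.vec j) =ᵐ[(volume : Measure ℍ).restrict F] fun z => c j * B.u j z := by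
          intro j
          filter_upwards [Lp.coeFn_smul (c j) (B.vec j), B.vec_coeFn j] with z hz hz'
          rw [hz, Pi.smul_apply, hz', smul_eq_mul]
        filter_upwards [Lp.coeFn_finsetSum Finset.univ (fun j => c j • B.vec j),
          ae_all_iff.mpr h2] with z hz hz'
        rw [hz, Finset.sum_apply]
        exact Finset.sum_congr rfl fun j _ => hz' j
      filter_upwards [huv, h1] with z hz hz'
      rw [hz', ← hz, hc z]
    rw [hv_eq]
    exact Submodule.sum_mem _ fun j _ => Submodule.smul_mem _ _ (Submodule.subset_span (Set.mem_range_self j))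
  -- contradiction: `v ∈ S ∩ Sᗮ = 0`
  have : v ∈ S ⊓ Sᗮ := Submodule.mem_inf.mpr ⟨hvS', hvS⟩
  rw [Submodule.inf_orthogonal_eq_bot, Submodule.mem_bot] at this
  exact hv0 this

end Main

end Fuchsian

end Literature.NumberTheory.Automorphic

end
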